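import Summits.QuantumFields.GaugeBoot.PlanarCertificateSoundnessTorus
import Summits.QuantumFields.GaugeBoot.PlanarBootstrapLargeN
import HarnessLib

/-!
# The conditional large-`N` theorem on a fixed torus: planar certificates bound the `U(N)` / `SU(N)` torus Wilson states as `N → ∞` GIVEN concentration of the imaginary parts (gauge-boot, large-`N` supplement 13)

HONEST FRAMING (cell `pub-gaugeboot`, page 1 of every file): the venture produces certified bounds
on lattice expectations at stated coupling, gauge group, dimension and torus size; NOT a mass gap,
NOT a continuum limit, NOT a string tension; NOT large `N` unless marked CONDITIONAL; NOT
Yang–Mills-summit-bearing (barriers `FixedCouplingUltralocality`, `PerturbativeInvisibility`).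
The torus analogue of supplement 5; the CONDITION (concentration on a fixed torus) is NOT discharged
here (the tree's SZZ variance fact is for infinite-volume limit points); this file certifies no number.

## Content

Fix a torus `(ℤ/L)^d`, a 't Hooft coupling `βt`, a base point `x`, and a valid planar certificate `P`
whose row words are closed and small for the torus.  For each `N` consider THE torus Wilson state of
`U(N)` (resp. `SU(N)`) at tree coupling `N·βt` (the cell's certified objects, indexed by `N`).

* `tendsto_shorDefectT_zero` — if `E_{N,βt,L}[(Im t_{ℓ_A})²] → 0` for the relaxation loops, the
  relaxation defects `γ_s → 0` (any family of compact structure groups `G_N` with measures `μ_N`);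
* ★★★ `PlanarCertificate.eventually_obj_le_uN_torus` — **`U(N)` on a fixed torus: IF the imaginary
  parts of the certificate's relaxation loops concentrate under the torus Wilson states as `N → ∞`,
  THEN `∀ δ > 0`, `obj(⟨W⟩_{N, N·βt, L}) ≤ bound + δ` for all large `N`** (identification rows assumed
  valid on each torus state);
* ★★★ `PlanarCertificate.eventually_obj_le_suN_torus` — the `SU(N)` twin, with the marked words'
  imaginary parts also required to concentrate.

[folklore] analysis; Kazakov–Zheng arXiv:2203.11360.
-/

noncomputable section

open MeasureTheory Filter Topology
open scoped BigOperators
open Literature.MathematicalPhysics.QuantumFieldTheory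
open Literature.MathematicalPhysics.QuantumLattice (fundamentalRep unitaryFundamentalRep continuous_fundamentalRep
  continuous_unitaryFundamentalRep)

namespace Summit.QuantumFields.GaugeBoot

variable {d L : ℕ}

/-! ## The defects on the torus vanish under concentration -/

section Defects

variable {G : ℕ → Type*} [∀ N, Group (G N)] [∀ N, TopologicalSpace (G N)] [∀ N, IsTopologicalGroup (G N)]
  [∀ N, CompactSpace (G N)] [∀ N, MeasurableSpace (G N)] [∀ N, BorelSpace (G N)]
  (ρ : (N : ℕ) → (G N →* Matrix (Fin N) (Fin N) ℂ))

/-- `Γ(A,B)² ≤ Γ(A,A)` on the torus (`|E[ab]| ≤ E|a| ≤ √E a²`). [folklore] -/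
theorem sq_loopImCovT_le {N : ℕ} (hρ : Continuous (ρ N)) (μ : Measure (GaugeConfig d L (G N))) [IsProbabilityMeasure μ]
    (x : Site d L) (A B : Word d) : loopImCovT (ρ N) μ x A B ^ 2 ≤ loopImCovT (ρ N) μ x A A := by
  rw [loopImCovT, loopImCovT]
  have h := sq_integral_mul_le_integral_sq (μ := μ)
    (Complex.continuous_im.comp_aestronglyMeasurable (aestronglyMeasurable_loopTrT (ρ N) hρ μ x A))
    (fun U => (Complex.abs_im_le_norm _).trans (norm_loopTrT_le_one (ρ N) hρ x A U))
    (fun U => (Complex.abs_im_le_norm _).trans (norm_loopTrT_le_one (ρ N) hρ x B U))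
  simpa only [sq] using h

/-- Mixed imaginary-part covariances on the torus vanish when the diagonal ones do. [folklore] -/
theorem tendsto_loopImCovT_zero (hρ : ∀ N, Continuous (ρ N)) (μ : (N : ℕ) → Measure (GaugeConfig d L (G N)))
    (hprob : ∀ᶠ N in atTop, IsProbabilityMeasure (μ N)) (x : Site d L) (A B : Word d)
    (hA : Tendsto (fun N => loopImCovT (ρ N) (μ N) x A A) atTop (𝓝 0)) :
    Tendsto (fun N => loopImCovT (ρ N) (μ N) x A B) atTop (𝓝 0) := by
  refine tendsto_zero_of_sq_le hA ?_
  filter_upwards [hprob] with N hN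
  exact sq_loopImCovT_le ρ (hρ N) (μ N) x A B

/-- **The relaxation defects on the torus vanish** under concentration of the relaxation loops'
imaginary parts. [folklore] -/
theorem tendsto_shorDefectT_zero (hρ : ∀ N, Continuous (ρ N)) (μ : (N : ℕ) → Measure (GaugeConfig d L (G N)))
    (P : PlanarCertificate d) (hprob : ∀ᶠ N in atTop, IsProbabilityMeasure (μ N)) (x : Site d L)
    (hIm : ∀ A, Tendsto (fun N => loopImCovT (ρ N) (μ N) x (P.shorLoop A) (P.shorLoop A)) atTop (𝓝 0))
    (s : Fin P.nS) : Tendsto (fun N => P.shorDefectT (ρ N) (μ N) x s) atTop (𝓝 0) := by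
  have hup : Tendsto (fun N => (P.nI : ℝ) * ∑ A, P.shorVec s A ^ 2 * loopImCovT (ρ N) (μ N) x (P.shorLoop A) (P.shorLoop A))
      atTop (𝓝 0) := by
    have h : Tendsto (fun N => ∑ A, P.shorVec s A ^ 2 * loopImCovT (ρ N) (μ N) x (P.shorLoop A) (P.shorLoop A))
        atTop (𝓝 (∑ A : Fin P.nI, P.shorVec s A ^ 2 * 0)) :=
      tendsto_finsetSum _ fun A _ => (hIm A).const_mul _
    simp only [mul_zero, Finset.sum_const_zero] at h
    simpa using h.const_mul (P.nI : ℝ)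
  refine tendsto_of_tendsto_of_tendsto_of_le_of_le' tendsto_const_nhds hup
    (Eventually.of_forall fun N => integral_nonneg fun _ => sq_nonneg _) ?_
  filter_upwards [hprob] with N hN
  have h := integral_sq_sum_im_le_card (μ := μ N) (P.shorVec s) (t := fun A => loopTrT (ρ N) x (P.shorLoop A))
    (fun A => aestronglyMeasurable_loopTrT (ρ N) (hρ N) (μ N) x _) (fun A U => norm_loopTrT_le_one (ρ N) (hρ N) x _ U)
  simp only [Fintype.card_fin] at h
  simpa only [PlanarCertificate.shorDefectT, loopImCovT, sq] using h

end Defects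

/-! ## The conditional large-`N` theorem on a fixed torus -/

namespace PlanarCertificate

variable (P : PlanarCertificate d) [NeZero L]

/-- ★★★ **`U(N)` ON A FIXED TORUS**: for a valid planar certificate `P` at `βt` with row words closed
and small for `(ℤ/L)^d` and identification rows valid on every torus Wilson state at tree coupling
`N·βt`: IF `E_{N}[(Im t_{ℓ_A})²] → 0` for the relaxation loops THEN for every `δ > 0`,
`obj(⟨W⟩_{N, N·βt, L}) ≤ bound + δ` for all large `N`. [folklore] -/
theorem eventually_obj_le_uN_torus (hP : P.IsValid) (x : Site d L)
    (hrow : ∀ r, Word.endpoint x (P.rowWord r) = x) (hsm : ∀ r, (P.rowWord r).Small L)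
    (hgram : ∀ j i, Word.endpoint x (P.gramWord j i) = x)
    (hlin : ∀ N, 1 ≤ N → ∀ e, P.lin e
      (loopWT (unitaryFundamentalRep (Fin N) ℂ) (wilsonMeasure (d := d) (L := L) (unitaryFundamentalRep (Fin N) ℂ) ((N : ℝ) * P.βt)) x)
      (loopQT (unitaryFundamentalRep (Fin N) ℂ) (wilsonMeasure (d := d) (L := L) (unitaryFundamentalRep (Fin N) ℂ) ((N : ℝ) * P.βt)) x) = 0)
    (hIm : ∀ A, Tendsto (fun N => loopImCovT (unitaryFundamentalRep (Fin N) ℂ)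
      (wilsonMeasure (d := d) (L := L) (unitaryFundamentalRep (Fin N) ℂ) ((N : ℝ) * P.βt)) x (P.shorLoop A) (P.shorLoop A)) atTop (𝓝 0)) :
    ∀ δ > 0, ∀ᶠ N in atTop, P.obj (loopWT (unitaryFundamentalRep (Fin N) ℂ)
      (wilsonMeasure (d := d) (L := L) (unitaryFundamentalRep (Fin N) ℂ) ((N : ℝ) * P.βt)) x) ≤ P.bound + δ := by
  intro δ hδ
  set μ : (N : ℕ) → Measure (GaugeConfig d L (Matrix.unitaryGroup (Fin N) ℂ)) :=
    fun N => wilsonMeasure (d := d) (L := L) (unitaryFundamentalRep (Fin N) ℂ) ((N : ℝ) * P.βt) with hμdef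
  have hprob : ∀ N, IsProbabilityMeasure (μ N) := fun N =>
    isProbabilityMeasure_wilsonMeasure (d := d) (L := L) _ (continuous_unitaryFundamentalRep (Fin N) ℂ) _
  set D : ℕ → ℝ := fun N => ∑ s, P.shorDefectT (unitaryFundamentalRep (Fin N) ℂ) (μ N) x s with hDdef
  have hD : Tendsto D atTop (𝓝 0) := by
    have h2 : Tendsto D atTop (𝓝 (∑ _s : Fin P.nS, (0 : ℝ))) :=
      tendsto_finsetSum _ fun s _ => tendsto_shorDefectT_zero (fun N => unitaryFundamentalRep (Fin N) ℂ)
        (fun N => continuous_unitaryFundamentalRep (Fin N) ℂ) μ P (Eventually.of_forall hprob) x hIm s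
    simp only [Finset.sum_const_zero] at h2
    exact h2
  have hle : ∀ᶠ N in atTop, P.obj (loopWT (unitaryFundamentalRep (Fin N) ℂ) (μ N) x) ≤ P.bound + D N := by
    filter_upwards [eventually_ge_atTop 1] with N hN
    exact P.obj_loopWT_le_uN hP (natCast_mul_div_natCast hN P.βt) x hrow hsm hgram (hlin N hN)
  have hDδ : ∀ᶠ N in atTop, D N < δ := (tendsto_order.1 hD).2 δ hδ
  filter_upwards [hle, hDδ] with N h1 h2
  linarith

/-- ★★★ **`SU(N)` ON A FIXED TORUS**: as above, with the marked words' imaginary parts also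
concentrating: `obj(⟨W⟩_{N, N·βt, L}) ≤ bound + δ` eventually. [folklore] -/
theorem eventually_obj_le_suN_torus (hP : P.IsValid) (x : Site d L)
    (hrow : ∀ r, Word.endpoint x (P.rowWord r) = x) (hsm : ∀ r, (P.rowWord r).Small L)
    (hgram : ∀ j i, Word.endpoint x (P.gramWord j i) = x)
    (hlin : ∀ N, 1 ≤ N → ∀ e, P.lin e
      (loopWT (fundamentalRep (Fin N)) (wilsonMeasure (d := d) (L := L) (fundamentalRep (Fin N)) ((N : ℝ) * P.βt)) x)
      (loopQT (fundamentalRep (Fin N)) (wilsonMeasure (d := d) (L := L) (fundamentalRep (Fin N)) ((N : ℝ) * P.βt)) x) = 0)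
    (hImShor : ∀ A, Tendsto (fun N => loopImCovT (fundamentalRep (Fin N))
      (wilsonMeasure (d := d) (L := L) (fundamentalRep (Fin N)) ((N : ℝ) * P.βt)) x (P.shorLoop A) (P.shorLoop A)) atTop (𝓝 0))
    (hImRow : ∀ r, Tendsto (fun N => loopImCovT (fundamentalRep (Fin N))
      (wilsonMeasure (d := d) (L := L) (fundamentalRep (Fin N)) ((N : ℝ) * P.βt)) x (P.rowWord r) (P.rowWord r)) atTop (𝓝 0)) :
    ∀ δ > 0, ∀ᶠ N in atTop, P.obj (loopWT (fundamentalRep (Fin N))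
      (wilsonMeasure (d := d) (L := L) (fundamentalRep (Fin N)) ((N : ℝ) * P.βt)) x) ≤ P.bound + δ := by
  intro δ hδ
  set μ : (N : ℕ) → Measure (GaugeConfig d L (Matrix.specialUnitaryGroup (Fin N) ℂ)) :=
    fun N => wilsonMeasure (d := d) (L := L) (fundamentalRep (Fin N)) ((N : ℝ) * P.βt) with hμdef
  have hprob : ∀ N, IsProbabilityMeasure (μ N) := fun N =>
    isProbabilityMeasure_wilsonMeasure (d := d) (L := L) _ (continuous_fundamentalRep (Fin N)) _
  -- row defects → 0
  have hrowD : ∀ r, Tendsto (fun N => P.rowDefectSuNT (μ N) x r) atTop (𝓝 0) := by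
    intro r
    have h1 : Tendsto (fun N : ℕ => ((P.rowWord r).length : ℝ) / (N : ℝ) ^ 2) atTop (𝓝 0) := tendsto_const_div_natCast_sq _
    have h2 : ∀ ν ε, Tendsto (fun N => |loopImCovT (fundamentalRep (Fin N)) (μ N) x (P.rowWord r) (plaqWord (P.rowAxis r) ν ε)|)
        atTop (𝓝 0) := fun ν ε =>
      (tendsto_zero_iff_abs_tendsto_zero _).1 (tendsto_loopImCovT_zero (fun N => fundamentalRep (Fin N))
        (fun N => continuous_fundamentalRep (Fin N)) μ (Eventually.of_forall hprob) x _ _ (hImRow r))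
    have h3 : Tendsto (fun N => |P.βt| * ∑ ν ∈ Finset.univ.erase (P.rowAxis r), ∑ ε : Bool,
        |loopImCovT (fundamentalRep (Fin N)) (μ N) x (P.rowWord r) (plaqWord (P.rowAxis r) ν ε)|) atTop (𝓝 0) := by
      have h : Tendsto (fun N => ∑ ν ∈ Finset.univ.erase (P.rowAxis r), ∑ ε : Bool,
          |loopImCovT (fundamentalRep (Fin N)) (μ N) x (P.rowWord r) (plaqWord (P.rowAxis r) ν ε)|) atTop
          (𝓝 (∑ ν ∈ Finset.univ.erase (P.rowAxis r), ∑ ε : Bool, (0 : ℝ))) :=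
        tendsto_finsetSum _ fun ν _ => tendsto_finsetSum _ fun ε _ => h2 ν ε
      simp only [Finset.sum_const_zero] at h
      simpa using h.const_mul |P.βt|
    have h := h1.add h3
    rw [add_zero] at h
    exact h
  set D : ℕ → ℝ := fun N => (∑ r, |P.rowMult r| * P.rowDefectSuNT (μ N) x r) +
    ∑ s, P.shorDefectT (fundamentalRep (Fin N)) (μ N) x s with hDdef
  have hD : Tendsto D atTop (𝓝 0) := by
    have h1 : Tendsto (fun N => ∑ r, |P.rowMult r| * P.rowDefectSuNT (μ N) x r) atTop (𝓝 (∑ r : Fin P.nR, |P.rowMult r| * 0)) :=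
      tendsto_finsetSum _ fun r _ => (hrowD r).const_mul _
    have h2 : Tendsto (fun N => ∑ s, P.shorDefectT (fundamentalRep (Fin N)) (μ N) x s) atTop (𝓝 (∑ _s : Fin P.nS, (0 : ℝ))) :=
      tendsto_finsetSum _ fun s _ => tendsto_shorDefectT_zero (fun N => fundamentalRep (Fin N))
        (fun N => continuous_fundamentalRep (Fin N)) μ P (Eventually.of_forall hprob) x hImShor s
    simp only [mul_zero, Finset.sum_const_zero] at h1 h2
    have h := h1.add h2
    rw [add_zero] at h
    exact h
  have hle : ∀ᶠ N in atTop, P.obj (loopWT (fundamentalRep (Fin N)) (μ N) x) ≤ P.bound + D N := by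
    filter_upwards [eventually_ge_atTop 1] with N hN
    have h := P.obj_loopWT_le_suN hP (natCast_mul_div_natCast hN P.βt) x hrow hsm hgram (hlin N hN)
    simpa [hDdef, add_assoc] using h
  have hDδ : ∀ᶠ N in atTop, D N < δ := (tendsto_order.1 hD).2 δ hδ
  filter_upwards [hle, hDδ] with N h1 h2
  linarith

end PlanarCertificate

end Summit.QuantumFields.GaugeBoot

end
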